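import Mathlib

/-!
# Sketch (stub-ideation k1 g7) — STUB `stub_cmLambdaLower` = RSL_g `ResidualSignedLambdaLowerCMAtTwo` (stmt-BirchSwinnertonDyer-22608)
# of skeleton `Cruxes/ResidualThetaCountLowerPureAtTwo/Lines/bt26_lambda.lean` (crux (R≥)ᵖ stmt-BirchSwinnertonDyer-26074)

Technique family: WEAKEN / STRENGTHEN, applied to the `v = 2` SEAM of the duality supply (STUB-PLAN rev 8 S2 `stub_plusColemanO`
«ρ-coefficient layer-pairing pin», DUALITY-KIT-g16 §2, PIN-SPEC-S2-g16, and the adopted ℤ₂-road k3-g6 D1/D2): the genuine Cartier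
pairing `e_ρ` of `ρ` and the componentwise W-pairing through the Θ-coordinates differ on `D₂` by an invertible matrix
`C = C(Θ, e_ρ) ∈ GL_n(ℤ₂)` that depends on `Θ` — and the crux quantifies over ALL `Θ`.

* STRONGEST PROVABLE FORM (rigidity, §2): on the Θ-model every decomposition-invariant bilinear pairing is a MATRIX TWIST
  `⟨x, y⟩_C = Σ C i j • e_W (x i) (y j)` (`exists_matrix_eq_twist` ⟸ rank one ⟸ Schur + perfectness `exists_smul_eq_of_schur`),
  with `C` unique (`twist_injective`); Θ-covariance `C ↦ Aᵀ C A` (`twist_matAct_matAct`, §4); `𝒪`-balanced twists (`twist_matAct_left_eq_twist_matAct_right`).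
* WEAKEST SUFFICIENT FORM (pin up to `GL_n(ℤ₂)`, §1, §3): every ONE-SIDED duality duty is twist-blind — right annihilators of
  product conditions (`rightAnn_twist_pi`, mirror `leftAnn_twist_pi`), stability of product conditions (`matrix_sum_smul_mem`), cancellation by an invertible
  matrix (`eq_zero_of_forall_sum_smul_eq_zero`), λ of a quotient moved by an automorphism (`finrank_baseChange_quotient_map_equiv`).
  (The currency descent `λ_ℤ₂ = n·λ_𝒪` is k3-g6's G1d, PROVED there — not restated.)

Pure (bi)linear algebra over a commutative ring `R` (read `ℤ/2^k`, `ℤ₂`); nothing about curves. 18 THEOREMS + four `def`s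
(`twist`, `rightAnn`, `leftAnn`, `matAct`); NO `sorry`, no instances / axioms.  BSD is NOT proved by any of this; 22608 / 26074 stay OPEN.
-/

set_option autoImplicit false
-- the Cruxes namespace of this sub repeats the summit name by design (D-0017 nested layout)
set_option linter.dupNamespace false

noncomputable section

open scoped TensorProduct Classical

namespace Summit.BirchSwinnertonDyer.BirchSwinnertonDyer.Cruxes.ResidualThetaCountLowerPureAtTwo.StubIdeasK1G7

universe u v w

/-! ## §1 Matrix twists of a bilinear pairing on product modules -/

section Twist

variable {R : Type u} [CommRing R] {ι : Type v} [Fintype ι] [DecidableEq ι]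
  {M N T : Type w} [AddCommGroup M] [Module R M] [AddCommGroup N] [Module R N] [AddCommGroup T] [Module R T]

/-- The matrix twist `⟨x, y⟩_C := Σ_{i j} C i j • e (x i) (y j)` of a bilinear pairing `e : M × N → T` on `(ι → M) × (ι → N)`.
(On the Θ-model: `e = ` the W-side layer / Weil / local Tate pairing, `C ∈ M_n(ℤ₂)`.) -/
def twist (C : Matrix ι ι R) (e : M →ₗ[R] N →ₗ[R] T) : (ι → M) →ₗ[R] (ι → N) →ₗ[R] T :=
  ∑ i, ∑ j, C i j • (e.comp (LinearMap.proj i)).compl₂ (LinearMap.proj j)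

omit [DecidableEq ι] in
@[simp] theorem twist_apply (C : Matrix ι ι R) (e : M →ₗ[R] N →ₗ[R] T) (x : ι → M) (y : ι → N) :
    twist C e x y = ∑ i, ∑ j, C i j • e (x i) (y j) := by
  simp [twist, LinearMap.sum_apply, LinearMap.smul_apply, LinearMap.compl₂_apply]

theorem twist_single_left (C : Matrix ι ι R) (e : M →ₗ[R] N →ₗ[R] T) (i : ι) (s : M) (y : ι → N) :
    twist C e (Pi.single i s) y = ∑ j, C i j • e s (y j) := by
  rw [twist_apply, Finset.sum_eq_single i]
  · simp
  · intro i' _ hi'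
    simp [Pi.single_eq_of_ne hi']
  · intro h
    exact absurd (Finset.mem_univ i) h

/-- Matrix entries are the values on coordinate vectors. -/
theorem twist_single_single (C : Matrix ι ι R) (e : M →ₗ[R] N →ₗ[R] T) (i j : ι) (m : M) (m' : N) :
    twist C e (Pi.single i m) (Pi.single j m') = C i j • e m m' := by
  rw [twist_single_left, Finset.sum_eq_single j]
  · simp
  · intro j' _ hj'
    simp [Pi.single_eq_of_ne hj']
  · intro h
    exact absurd (Finset.mem_univ j) h

/-- **(R2, uniqueness)** the twist matrix is unique as soon as no nonzero scalar kills all values of `e` (Weil pairing onto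
`μ_{2^k}`, scalars `ℤ/2^k`): the compatible system `(C_k)_k` of the card is well defined and gives `C ∈ M_n(ℤ₂)`. [folklore] -/
theorem twist_injective (e : M →ₗ[R] N →ₗ[R] T) (hfull : ∀ r : R, (∀ (m : M) (m' : N), r • e m m' = 0) → r = 0)
    {C C' : Matrix ι ι R} (h : twist C e = twist C' e) : C = C' := by
  ext i j
  rw [← sub_eq_zero]
  refine hfull _ fun m m' ↦ ?_
  have hij := congrArg (fun B : (ι → M) →ₗ[R] (ι → N) →ₗ[R] T ↦ B (Pi.single i m) (Pi.single j m')) h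
  simp only [twist_single_single] at hij
  rw [sub_smul, sub_eq_zero]
  exact hij

omit [DecidableEq ι] in
/-- (R4, stability) Product conditions `Sⁿ` are stable under every matrix: the transported local condition `⊕ E⁺` and its
annihilator do not see WHICH `𝒪`-structure / which twist is used. [folklore] -/
theorem matrix_sum_smul_mem (C : Matrix ι ι R) (S : Submodule R M) {x : ι → M} (hx : ∀ j, x j ∈ S) (i : ι) :
    ∑ j, C i j • x j ∈ S :=
  Submodule.sum_mem _ fun j _ ↦ S.smul_mem _ (hx j)

/-- Cancellation by an invertible matrix acting on module-valued vectors (adjugate trick). [folklore] -/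
theorem eq_zero_of_forall_sum_smul_eq_zero {C : Matrix ι ι R} (hC : IsUnit C.det) {v : ι → T}
    (h : ∀ i, ∑ j, C i j • v j = 0) : v = 0 := by
  funext k
  have key : ∑ i, C.adjugate k i • ∑ j, C i j • v j = C.det • v k := by
    simp_rw [Finset.smul_sum, smul_smul]
    rw [Finset.sum_comm]
    simp_rw [← Finset.sum_smul]
    have hmul : ∀ j, ∑ i, C.adjugate k i * C i j = (C.adjugate * C) k j := fun j ↦ (Matrix.mul_apply).symm
    simp_rw [hmul, Matrix.adjugate_mul, Matrix.smul_apply, Matrix.one_apply, smul_eq_mul, mul_ite, mul_one,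
      mul_zero, ite_smul, zero_smul, Finset.sum_ite_eq, Finset.mem_univ, if_true]
  have h0 : ∑ i, C.adjugate k i • ∑ j, C i j • v j = 0 := by simp [h]
  rw [h0] at key
  exact (hC.smul_eq_zero).1 key.symm

/-- Right annihilator of a set under a bilinear pairing. -/
def rightAnn {X : Type*} {Y : Type*} [AddCommGroup X] [Module R X] [AddCommGroup Y] [Module R Y]
    (B : X →ₗ[R] Y →ₗ[R] T) (S : Set X) : Set Y :=
  {y | ∀ x ∈ S, B x y = 0}

/-- **(ORTH-invariance)** For an INVERTIBLE twist the right annihilator of a product condition `Sⁿ` under `⟨·,·⟩_C` is the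
product of the W-side annihilators — so «the transported plus condition is (its own) exact annihilator» holds for the genuine
(unknown-`C`) pairing of `ρ` iff it holds for W componentwise. [folklore] -/
theorem rightAnn_twist_pi {C : Matrix ι ι R} (hC : IsUnit C.det) (e : M →ₗ[R] N →ₗ[R] T) (S : Submodule R M) :
    rightAnn (twist C e) (Set.pi Set.univ fun _ ↦ (S : Set M)) = Set.pi Set.univ fun _ ↦ rightAnn e (S : Set M) := by
  ext y
  simp only [rightAnn, Set.mem_setOf_eq, Set.mem_pi, Set.mem_univ, true_implies, SetLike.mem_coe]
  constructor
  · intro hy j s hs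
    have hv : (fun j ↦ e s (y j)) = 0 := by
      refine eq_zero_of_forall_sum_smul_eq_zero (T := T) hC fun i ↦ ?_
      have := hy (Pi.single i s) fun k ↦ by
        rcases eq_or_ne k i with rfl | hk
        · simpa using hs
        · simp [Pi.single_eq_of_ne hk]
      rwa [twist_single_left] at this
    exact congr_fun hv j
  · intro hy x hx
    rw [twist_apply]
    exact Finset.sum_eq_zero fun i _ ↦ Finset.sum_eq_zero fun j _ ↦ by rw [hy j (x i) (hx i), smul_zero]

/-- Values on a coordinate vector on the RIGHT. -/
theorem twist_single_right (C : Matrix ι ι R) (e : M →ₗ[R] N →ₗ[R] T) (x : ι → M) (j : ι) (s : N) :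
    twist C e x (Pi.single j s) = ∑ i, C i j • e (x i) s := by
  rw [twist_apply]
  refine Finset.sum_congr rfl fun i _ ↦ ?_
  rw [Finset.sum_eq_single j]
  · simp
  · intro j' _ hj'
    simp [Pi.single_eq_of_ne hj']
  · intro h
    exact absurd (Finset.mem_univ j) h

/-- Cancellation by an invertible matrix acting through its COLUMNS (transpose of `eq_zero_of_forall_sum_smul_eq_zero`). -/
theorem eq_zero_of_forall_sum_smul_eq_zero' {C : Matrix ι ι R} (hC : IsUnit C.det) {v : ι → T}
    (h : ∀ j, ∑ i, C i j • v i = 0) : v = 0 := by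
  refine eq_zero_of_forall_sum_smul_eq_zero (C := C.transpose) (T := T) ?_ fun j ↦ ?_
  · rwa [Matrix.det_transpose]
  · simpa only [Matrix.transpose_apply] using h j

/-- Left annihilator of a set under a bilinear pairing. -/
def leftAnn {X : Type*} {Y : Type*} [AddCommGroup X] [Module R X] [AddCommGroup Y] [Module R Y]
    (B : X →ₗ[R] Y →ₗ[R] T) (S : Set Y) : Set X :=
  {x | ∀ y ∈ S, B x y = 0}

/-- **(ORTH-invariance, compact side)** the mirror statement: the LEFT annihilator (in the `T`-side `(T/2^k)ⁿ ≅ (W[2^k])ⁿ`) of a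
product condition `(E⁺-classes)ⁿ` under the genuine pairing `⟨·,·⟩_C` is the product of W's annihilators `(E⁺)^⊥ = ker Col⁺_W`
componentwise: the Coleman coordinate `Col⁺_W^{⊕ n} ∘ Θ_T` factors the GENUINE pairing although it is the naive transport. [folklore] -/
theorem leftAnn_twist_pi {C : Matrix ι ι R} (hC : IsUnit C.det) (e : M →ₗ[R] N →ₗ[R] T) (S : Submodule R N) :
    leftAnn (twist C e) (Set.pi Set.univ fun _ ↦ (S : Set N)) = Set.pi Set.univ fun _ ↦ leftAnn e (S : Set N) := by
  ext x
  simp only [leftAnn, Set.mem_setOf_eq, Set.mem_pi, Set.mem_univ, true_implies, SetLike.mem_coe]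
  constructor
  · intro hx i s hs
    have hv : (fun i ↦ e (x i) s) = 0 := by
      refine eq_zero_of_forall_sum_smul_eq_zero' (T := T) hC fun j ↦ ?_
      have := hx (Pi.single j s) fun k ↦ by
        rcases eq_or_ne k j with rfl | hk
        · simpa using hs
        · simp [Pi.single_eq_of_ne hk]
      rwa [twist_single_right] at this
    exact congr_fun hv i
  · intro hx y hy
    rw [twist_apply]
    exact Finset.sum_eq_zero fun i _ ↦ Finset.sum_eq_zero fun j _ ↦ by rw [hx i (y j) (hy j), smul_zero]

end Twist

/-! ## §2 Rigidity: invariant pairings on the Θ-model are matrix twists -/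

section Rigidity

variable {R : Type u} [CommRing R] {ι : Type v} [Fintype ι] [DecidableEq ι]
  {M T : Type w} [AddCommGroup M] [Module R M] [AddCommGroup T] [Module R T]
  {G : Type*} [Group G] [DistribMulAction G M] [DistribMulAction G T]

/-- **(R2, rank one ⟸ Schur + perfect)** If every `G`-equivariant `R`-endomorphism of `M` is a scalar (integral Schur:
`End_{ℤ₂[D_v]}(T₂W) = ℤ₂`, the tree's `ThetaTransport.decomp_equivariant_addMonoidHom_primary_eq_nsmul`) and `e` is `G`-invariant and
left-perfect (`x ↦ e x` bijective onto `Hom(M, T)`: Weil / local Tate duality, `weilTowerPk_nondegenerate`), then every `G`-invariant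
bilinear `b : M × M → T` is `c • e`. [cite: SerreAbelianLadic1968, I §1.1; Cornell–Silverman–Stevens 1997, Ch. VIII §4 Cor. (Schur's Lemma), p. 319] -/
theorem exists_smul_eq_of_schur (e : M →ₗ[R] M →ₗ[R] T)
    (hS : ∀ f : M →ₗ[R] M, (∀ (g : G) (m : M), f (g • m) = g • f m) → ∃ c : R, ∀ m, f m = c • m)
    (he : ∀ (g : G) (x y : M), e (g • x) (g • y) = g • e x y) (hbij : Function.Bijective e)
    (b : M →ₗ[R] M →ₗ[R] T) (hb : ∀ (g : G) (x y : M), b (g • x) (g • y) = g • b x y) :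
    ∃ c : R, b = c • e := by
  let E : M ≃ₗ[R] (M →ₗ[R] T) := LinearEquiv.ofBijective e hbij
  let φ : M →ₗ[R] M := (E.symm : (M →ₗ[R] T) →ₗ[R] M).comp b
  have hEφ : ∀ x, e (φ x) = b x := fun x ↦ by
    change E (E.symm (b x)) = b x
    exact E.apply_symm_apply (b x)
  have hφ : ∀ (g : G) (x : M), φ (g • x) = g • φ x := by
    intro g x
    apply hbij.1
    refine LinearMap.ext fun y ↦ ?_
    rw [hEφ]
    have h1 : b (g • x) y = g • b x (g⁻¹ • y) := by
      conv_lhs => rw [← smul_inv_smul g y]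
      exact hb g x (g⁻¹ • y)
    have h2 : e (g • φ x) y = g • e (φ x) (g⁻¹ • y) := by
      conv_lhs => rw [← smul_inv_smul g y]
      exact he g (φ x) (g⁻¹ • y)
    rw [h1, h2, hEφ]
  obtain ⟨c, hc⟩ := hS φ hφ
  refine ⟨c, LinearMap.ext fun x ↦ LinearMap.ext fun y ↦ ?_⟩
  rw [← hEφ x, hc x, map_smul]
  simp only [LinearMap.smul_apply]

omit [Fintype ι] in
theorem smul_single (g : G) (i : ι) (m : M) : g • (Pi.single i m : ι → M) = Pi.single i (g • m) :=
  (Pi.single_smul' i g m).symm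

/-- **(R2, classification on products = the strongest provable form of the S2 pin)** Under the rank-one hypothesis `hP` for
`(M, e)` (every `G`-invariant pairing on `M` is a scalar multiple of `e`), every pairing on `(ι → M) × (ι → M)` invariant for the
DIAGONAL action is a matrix twist `⟨x, y⟩_C = Σ C i j • e (x i) (y j)`.  Reading: `M = T₂W`-layer / `W[2^k]`, `G = D_v` (`v ∣ 2`),
`ι = Fin n`, the Θ-model of `A_ρ`; the genuine local Tate pairing of `ρ` at `2` IS `⟨·,·⟩_C` for some `C ∈ M_n(ℤ₂)`, invertible by
perfectness — no construction of `C` is ever needed downstream (§1). [folklore; Schur] -/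
theorem exists_matrix_eq_twist (e : M →ₗ[R] M →ₗ[R] T)
    (hP : ∀ b : M →ₗ[R] M →ₗ[R] T, (∀ (g : G) (x y : M), b (g • x) (g • y) = g • b x y) → ∃ c : R, b = c • e)
    (B : (ι → M) →ₗ[R] (ι → M) →ₗ[R] T) (hB : ∀ (g : G) (x y : ι → M), B (g • x) (g • y) = g • B x y) :
    ∃ C : Matrix ι ι R, B = twist C e := by
  -- coordinate pairings `b i j m m' := B (single i m) (single j m')`
  let b : ι → ι → (M →ₗ[R] M →ₗ[R] T) := fun i j ↦
    (B.comp (LinearMap.single R (fun _ : ι ↦ M) i)).compl₂ (LinearMap.single R (fun _ : ι ↦ M) j)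
  have hb_apply : ∀ i j (m m' : M), b i j m m' = B (Pi.single i m) (Pi.single j m') := fun i j m m' ↦ rfl
  have hb : ∀ i j, ∀ (g : G) (x y : M), b i j (g • x) (g • y) = g • b i j x y := by
    intro i j g x y
    rw [hb_apply, hb_apply, ← smul_single, ← smul_single, hB]
  choose C hC using fun i j ↦ hP (b i j) (hb i j)
  refine ⟨Matrix.of fun i j ↦ C i j, LinearMap.ext fun x ↦ LinearMap.ext fun y ↦ ?_⟩
  have hx : x = ∑ i, Pi.single i (x i) := (Finset.univ_sum_single x).symm
  have hy : y = ∑ j, Pi.single j (y j) := (Finset.univ_sum_single y).symm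
  rw [twist_apply]
  conv_lhs => rw [hx, map_sum, LinearMap.sum_apply]
  refine Finset.sum_congr rfl fun i _ ↦ ?_
  conv_lhs => rw [hy, map_sum]
  refine Finset.sum_congr rfl fun j _ ↦ ?_
  have h1 : B (Pi.single i (x i)) (Pi.single j (y j)) = b i j (x i) (y j) := (hb_apply i j _ _).symm
  rw [h1, hC i j, LinearMap.smul_apply, LinearMap.smul_apply, Matrix.of_apply]

end Rigidity

/-! ## §3 λ does not see an automorphism (the VALUE duty `hm` / `hi` is twist-invariant) -/

section Lambda

variable {A : Type u} [CommRing A] (K : Type w) [Field K] [Algebra A K]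
  {P : Type v} [AddCommGroup P] [Module A P]

/-- **(VALUE-invariance)** `λ(P ⧸ γ(N)) = λ(P ⧸ N)` for an automorphism `γ` of the compact local side `P` — an unknown invertible
twist `C` (§2) moving the zeta image `locd(Z)` inside `P ≅ Λⁿ` does not change `hm : m ≤ λ(P ⧸ locd Z)` of
`CharIdealLambda.le_finrank_baseChange_characterModule_of_duality`. [folklore] -/
theorem finrank_baseChange_quotient_map_equiv (γ : P ≃ₗ[A] P) (N : Submodule A P) :
    Module.finrank K (K ⊗[A] (P ⧸ N.map (γ : P →ₗ[A] P))) = Module.finrank K (K ⊗[A] (P ⧸ N)) :=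
  (((Submodule.Quotient.equiv N (N.map (γ : P →ₗ[A] P)) γ rfl).baseChange A K _ _).finrank_eq).symm

end Lambda

/-! ## §4 `𝒪`-balanced twists (when the `𝒪`-currency is kept) -/

section Balanced

variable {R : Type u} [CommRing R] {ι : Type v} [Fintype ι] [DecidableEq ι]
  {M N T : Type w} [AddCommGroup M] [Module R M] [AddCommGroup N] [Module R N] [AddCommGroup T] [Module R T]

/-- The Schur matrix action of a coefficient `a ∈ 𝒪` on the Θ-model: `(a ⋆ x) i = Σ_l B i l • x l`
(the tree's `ThetaTransport.decomp_equivariant_addMonoidHom_pi_primary_eq_sum_nsmul`). -/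
def matAct (B : Matrix ι ι R) (x : ι → M) : ι → M := fun i ↦ ∑ l, B i l • x l

omit [DecidableEq ι] in
/-- Change of coordinates on the LEFT argument: `⟨B⋆x, y⟩_C = ⟨x, y⟩_{Bᵀ C}`. [folklore] -/
theorem twist_matAct_left (C B : Matrix ι ι R) (e : M →ₗ[R] N →ₗ[R] T) (x : ι → M) (y : ι → N) :
    twist C e (matAct B x) y = twist (B.transpose * C) e x y := by
  have lhs : twist C e (matAct B x) y = ∑ j, ∑ l, (∑ i, B i l * C i j) • e (x l) (y j) := by
    rw [twist_apply]
    simp only [matAct, map_sum, map_smul, LinearMap.sum_apply, LinearMap.smul_apply, Finset.smul_sum, smul_smul]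
    rw [Finset.sum_comm]
    refine Finset.sum_congr rfl fun j _ ↦ ?_
    rw [Finset.sum_comm]
    refine Finset.sum_congr rfl fun l _ ↦ ?_
    rw [Finset.sum_smul]
    exact Finset.sum_congr rfl fun i _ ↦ by rw [mul_comm]
  rw [lhs, twist_apply, Finset.sum_comm]
  refine Finset.sum_congr rfl fun l _ ↦ Finset.sum_congr rfl fun j _ ↦ ?_
  rw [Matrix.mul_apply]
  simp only [Matrix.transpose_apply]

omit [DecidableEq ι] in
/-- Change of coordinates on the RIGHT argument: `⟨x, B⋆y⟩_C = ⟨x, y⟩_{C B}`. [folklore] -/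
theorem twist_matAct_right (C B : Matrix ι ι R) (e : M →ₗ[R] N →ₗ[R] T) (x : ι → M) (y : ι → N) :
    twist C e x (matAct B y) = twist (C * B) e x y := by
  have rhs : twist C e x (matAct B y) = ∑ j, ∑ l, (∑ i, C l i * B i j) • e (x l) (y j) := by
    rw [twist_apply]
    simp only [matAct, map_sum, map_smul, Finset.smul_sum, smul_smul]
    have h1 : (∑ a, ∑ b, ∑ c, (C a b * B b c) • e (x a) (y c)) = ∑ a, ∑ c, ∑ b, (C a b * B b c) • e (x a) (y c) :=
      Finset.sum_congr rfl fun a _ ↦ Finset.sum_comm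
    rw [h1, Finset.sum_comm]
    refine Finset.sum_congr rfl fun c _ ↦ Finset.sum_congr rfl fun a _ ↦ ?_
    rw [Finset.sum_smul]
  rw [rhs, twist_apply, Finset.sum_comm]
  refine Finset.sum_congr rfl fun l _ ↦ Finset.sum_congr rfl fun j _ ↦ ?_
  rw [Matrix.mul_apply]

omit [DecidableEq ι] in
/-- **(Θ-covariance)** replacing `Θ` by `A ∘ Θ` (any `A ∈ GL_n(ℤ₂)` is allowed by integral Schur: the crux quantifies over ALL
`Θ`) moves BOTH coordinate vectors by `A` and the pairing matrix by `C ↦ Aᵀ C A`: a statement on the `∀ Θ`-path must be invariant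
under this move (unit test (Θ-cov) of the card). [folklore] -/
theorem twist_matAct_matAct (C A : Matrix ι ι R) (e : M →ₗ[R] N →ₗ[R] T) (x : ι → M) (y : ι → N) :
    twist C e (matAct A x) (matAct A y) = twist (A.transpose * C * A) e x y := by
  rw [twist_matAct_left, twist_matAct_right]

omit [DecidableEq ι] in
/-- **(R3, balancedness)** if the Schur matrices `B`, `B'` of one coefficient `a ∈ 𝒪` acting on the two sides satisfy
`Bᵀ C = C B'`, the twist `⟨·,·⟩_C` is `a`-balanced: `⟨B⋆x, y⟩_C = ⟨x, B'⋆y⟩_C`.  (On the Θ-model `B = B'` and the balanced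
`C` are `{C_ψ : ψ ∈ Hom_ℤ₂(𝒪, ℤ₂)}`, a free rank-one `𝒪`-module; the perfect ones are `𝒪ˣ · C_ψ₀` — the «pin up to a unit».) [folklore] -/
theorem twist_matAct_left_eq_twist_matAct_right (C B B' : Matrix ι ι R) (e : M →ₗ[R] N →ₗ[R] T)
    (hcomm : B.transpose * C = C * B') (x : ι → M) (y : ι → N) :
    twist C e (matAct B x) y = twist C e x (matAct B' y) := by
  rw [twist_matAct_left, twist_matAct_right, hcomm]

end Balanced



end Summit.BirchSwinnertonDyer.BirchSwinnertonDyer.Cruxes.ResidualThetaCountLowerPureAtTwo.StubIdeasK1G7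

end
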